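import Summits.CriticalPhenomena.PercolationContinuityZ3.Theorems.PercNearOneGluingNoHeavyQuantFarTwoAnchorLoaded
import Summits.CriticalPhenomena.PercolationContinuityZ3.Theorems.PercNearOneGluingNoHeavyQuantFarTwoAnchorTransfer
import HarnessLib

/-!
# QUANT lane R8, front "FAR beyond trees", layer one — TWO-ANCHOR BLOCKS with RELAY ANCHORS: the transfer theorem and its FAR form

builds on p205010 (kernel theorem, internal audit signed; external expert review pending)

Support file (`--supports stmt-CriticalPhenomena-4575`), seat `prim-quant-p1` (gen 19); memo
`run/shared/lean/prim/quant/prim-quant-p1-g19/FOR-LEAD-CACTI.md` §5.  Standard axioms; no sorries; no definitions.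

The versions of `Block.real_card_le_one_le_twoAnchor`, `Block.real_openConn_decouple_eq`, `Block.farLayerOne_twoAnchor` in which the block relays
may be leaves OR the anchors themselves (`A ∩ Z ⊆ L ∪ {v₁, v₂}`) — the form needed by cacti, whose cycle vertices are usually relays.  The loaded
count at `vᵢ` is `Yᵢ + 𝟙[vᵢ ∈ A]` (`…TwoAnchorLoaded`); a relay anchor has internal marginal `mᵢ` and `uᵢ = 1`, so `q ≤ mᵢuᵢ` persists and the
two-anchor algebra applies verbatim.
* `Block.real_hair_laws_loaded`, **`Block.real_card_le_one_le_twoAnchor_loaded`**, `Block.real_openConn_decouple_eq_loaded`,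
  **`Block.farLayerOne_twoAnchor_loaded`** (the `j = 1` FAR instance transfers from the decoupled graph).
[cite: Grimmett1999, §1.3 p. 10; §2.2; Thm. (2.4) p. 34]; the theorems [this work].
-/

noncomputable section

namespace Summit.CriticalPhenomena.PercolationContinuityZ3.Theorems

namespace Quant

namespace Block

open Finset MeasureTheory Set
open Literature.Probability.LatticeModels
open Literature.Probability.Percolation
open Bundle (offZ avoid real_offZ_event_eq_of_agree)
open scoped Classical

variable {n : ℕ} {o c v₁ v₂ : Fin n} {Z L : Finset (Fin n)} {par : Fin n → Fin n}

/-- Law of a loaded count: `P(Y + b ≥ 1) = P(Y + b = 1) + P(Y + b ≥ 2)` and `P(Y + b = 0) = 1 − P(Y + b ≥ 1)`. [folklore] -/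
theorem real_hair_laws_loaded (μ : Measure (BondConfig (Fin n))) [IsProbabilityMeasure μ] (v : Fin n) (B : Finset (Fin n)) (b : ℕ) :
    μ.real {ω | 1 ≤ (B.filter fun ℓ => s(v, ℓ) ∈ ω).card + b} =
        μ.real {ω | (B.filter fun ℓ => s(v, ℓ) ∈ ω).card + b = 1} + μ.real {ω | 2 ≤ (B.filter fun ℓ => s(v, ℓ) ∈ ω).card + b} ∧
      μ.real {ω | (B.filter fun ℓ => s(v, ℓ) ∈ ω).card + b = 0} = 1 - μ.real {ω | 1 ≤ (B.filter fun ℓ => s(v, ℓ) ∈ ω).card + b} := by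
  have hmeas : ∀ U : Set (BondConfig (Fin n)), MeasurableSet U := fun U => (Set.toFinite U).measurableSet
  constructor
  · have h := measureReal_inter_add_sdiff (μ := μ) (s := {ω : BondConfig (Fin n) | 1 ≤ (B.filter fun ℓ => s(v, ℓ) ∈ ω).card + b})
      (hmeas {ω | 2 ≤ (B.filter fun ℓ => s(v, ℓ) ∈ ω).card + b})
    have e1 : {ω : BondConfig (Fin n) | 1 ≤ (B.filter fun ℓ => s(v, ℓ) ∈ ω).card + b} ∩ {ω | 2 ≤ (B.filter fun ℓ => s(v, ℓ) ∈ ω).card + b} =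
        {ω | 2 ≤ (B.filter fun ℓ => s(v, ℓ) ∈ ω).card + b} := by
      ext ω; simp only [Set.mem_inter_iff, mem_setOf_eq]; omega
    have e2 : {ω : BondConfig (Fin n) | 1 ≤ (B.filter fun ℓ => s(v, ℓ) ∈ ω).card + b} \ {ω | 2 ≤ (B.filter fun ℓ => s(v, ℓ) ∈ ω).card + b} =
        {ω | (B.filter fun ℓ => s(v, ℓ) ∈ ω).card + b = 1} := by
      ext ω; simp only [Set.mem_sdiff, mem_setOf_eq]; omega
    rw [e1, e2] at h; linarith
  · have e3 : {ω : BondConfig (Fin n) | (B.filter fun ℓ => s(v, ℓ) ∈ ω).card + b = 0} =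
        {ω : BondConfig (Fin n) | 1 ≤ (B.filter fun ℓ => s(v, ℓ) ∈ ω).card + b}ᶜ := by
      ext ω; simp only [Set.mem_compl_iff, mem_setOf_eq]; omega
    rw [e3, probReal_compl_eq_one_sub (hmeas _)]

/-- **TWO-ANCHOR TRANSFER with relay anchors.**  As `Block.real_card_le_one_le_twoAnchor`, but the block relays may include the anchors
themselves (`A ∩ Z ⊆ L ∪ {v₁, v₂}`): `P_{w'}(N ≤ 1) ≤ t` for the decoupled weights and `P_w(o ↮ a) ≤ t` on the block relays imply `P_w(N ≤ 1) ≤ t`.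
[this work] -/
theorem real_card_le_one_le_twoAnchor_loaded (H : IsTwoAnchor c v₁ v₂ Z L par) (w : Sym2 (Fin n) → unitInterval) (ho : o ∉ Z)
    (hwZ : ∀ x y : Fin n, x ≠ y → x ∈ Z → y ∉ Z → y ≠ c → (w s(x, y) : ℝ) = 0)
    (hwL : ∀ ℓ ∈ L, ∀ x : Fin n, x ≠ ℓ → x ≠ par ℓ → (w s(ℓ, x) : ℝ) = 0)
    (A : Finset (Fin n)) (hA : A ∩ Z ⊆ L ∪ {v₁, v₂}) (hAZ : (A ∩ Z).Nonempty)
    (t : ℝ) (hcut : ∀ a ∈ A ∩ Z, (prodBernoulli w).real (openConn o a)ᶜ ≤ t)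
    (hfar' : (prodBernoulli (decouple c v₁ v₂ Z L par w)).real
      {ω : BondConfig (Fin n) | (A.filter fun a => ω ∈ openConn o a).card ≤ 1} ≤ t) :
    (prodBernoulli w).real {ω : BondConfig (Fin n) | (A.filter fun a => ω ∈ openConn o a).card ≤ 1} ≤ t := by
  set w' := decouple c v₁ v₂ Z L par w with hw'
  set μ := prodBernoulli w with hμ
  set μ' := prodBernoulli w' with hμ'
  have hmeas : ∀ U : Set (BondConfig (Fin n)), MeasurableSet U := fun U => (Set.toFinite U).measurableSet
  have hw'L : ∀ ℓ ∈ L, ∀ x : Fin n, x ≠ ℓ → x ≠ par ℓ → (w' s(ℓ, x) : ℝ) = 0 := decouple_leaf_vanish H w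
  -- core events and their probabilities
  set E₁ := {ω : BondConfig (Fin n) | core Z L ω ∈ openConn c v₁} with hE₁
  set E₂ := {ω : BondConfig (Fin n) | core Z L ω ∈ openConn c v₂} with hE₂
  set m₁ := μ.real E₁ with hm₁
  set m₂ := μ.real E₂ with hm₂
  set p := μ.real (E₁ ∩ E₂) with hp
  have hm₁0 : 0 ≤ m₁ := measureReal_nonneg
  have hm₂0 : 0 ≤ m₂ := measureReal_nonneg
  have hp₁ : p ≤ m₁ := measureReal_mono Set.inter_subset_left
  have hp₂ : p ≤ m₂ := measureReal_mono Set.inter_subset_right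
  have hpm : m₁ * m₂ ≤ p := prodBernoulli_harris w (isUpperSet_coreReach c v₁ Z L) (isUpperSet_coreReach c v₂ Z L) (hmeas _) (hmeas _)
  have h10 : μ.real (E₁ \ E₂) = m₁ - p := by
    have := measureReal_inter_add_sdiff (μ := μ) (s := E₁) (hmeas E₂); linarith
  have h01 : μ.real (E₂ \ E₁) = m₂ - p := by
    have := measureReal_inter_add_sdiff (μ := μ) (s := E₂) (hmeas E₁); rw [Set.inter_comm] at this; linarith
  have hm₁' : μ'.real E₁ = m₁ := real_coreReach_decouple₁ H w
  have hm₂' : μ'.real E₂ = m₂ := real_coreReach_decouple₂ H w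
  have hp' : μ'.real (E₁ ∩ E₂) = m₁ * m₂ := real_coreReach_inter_decouple H w
  have h10' : μ'.real (E₁ \ E₂) = m₁ - m₁ * m₂ := by
    have := measureReal_inter_add_sdiff (μ := μ') (s := E₁) (hmeas E₂); linarith
  have h01' : μ'.real (E₂ \ E₁) = m₂ - m₁ * m₂ := by
    have := measureReal_inter_add_sdiff (μ := μ') (s := E₂) (hmeas E₁); rw [Set.inter_comm] at this; linarith
  -- hair laws
  set A₁ := ((A ∩ L) ∩ Z).filter fun a => par a = v₁ with hA₁def
  set A₂ := ((A ∩ L) ∩ Z).filter fun a => par a = v₂ with hA₂def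
  have hA₁L : A₁ ⊆ L := fun a ha => (mem_inter.1 (mem_inter.1 (mem_filter.1 ha).1).1).2
  have hA₂L : A₂ ⊆ L := fun a ha => (mem_inter.1 (mem_inter.1 (mem_filter.1 ha).1).1).2
  set b₁ : ℕ := (if v₁ ∈ A then 1 else 0) with hb₁
  set b₂ : ℕ := (if v₂ ∈ A then 1 else 0) with hb₂
  have hpar₁ : ∀ ℓ ∈ A₁, par ℓ = v₁ := fun ℓ hℓ => (mem_filter.1 hℓ).2
  have hpar₂ : ∀ ℓ ∈ A₂, par ℓ = v₂ := fun ℓ hℓ => (mem_filter.1 hℓ).2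
  set s₁ := μ.real {ω | ((A₁.filter fun ℓ => s(v₁, ℓ) ∈ ω).card + b₁) = 1} with hs₁
  set d₁ := μ.real {ω | 2 ≤ ((A₁.filter fun ℓ => s(v₁, ℓ) ∈ ω).card + b₁)} with hd₁
  set u₁ := μ.real {ω | 1 ≤ ((A₁.filter fun ℓ => s(v₁, ℓ) ∈ ω).card + b₁)} with hu₁
  set z₁ := μ.real {ω | ((A₁.filter fun ℓ => s(v₁, ℓ) ∈ ω).card + b₁) = 0} with hz₁
  set s₂ := μ.real {ω | ((A₂.filter fun ℓ => s(v₂, ℓ) ∈ ω).card + b₂) = 1} with hs₂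
  set d₂ := μ.real {ω | 2 ≤ ((A₂.filter fun ℓ => s(v₂, ℓ) ∈ ω).card + b₂)} with hd₂
  set u₂ := μ.real {ω | 1 ≤ ((A₂.filter fun ℓ => s(v₂, ℓ) ∈ ω).card + b₂)} with hu₂
  obtain ⟨hu₁eq, hz₁eq⟩ := real_hair_laws_loaded μ v₁ A₁ b₁
  obtain ⟨hu₂eq, -⟩ := real_hair_laws_loaded μ v₂ A₂ b₂
  have hu : u₁ = s₁ + d₁ := hu₁eq
  have hz : z₁ = 1 - u₁ := hz₁eq
  have hu' : u₂ = s₂ + d₂ := hu₂eq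
  have hs₁0 : 0 ≤ s₁ := measureReal_nonneg
  have hd₁0 : 0 ≤ d₁ := measureReal_nonneg
  have hs₂0 : 0 ≤ s₂ := measureReal_nonneg
  have hd₂0 : 0 ≤ d₂ := measureReal_nonneg
  have hu₁1 : u₁ ≤ 1 := measureReal_le_one
  have hu₂1 : u₂ ≤ 1 := measureReal_le_one
  -- the same hair laws under `w'`
  have hs₁' : μ'.real {ω | ((A₁.filter fun ℓ => s(v₁, ℓ) ∈ ω).card + b₁) = 1} = s₁ := real_hair_decouple H w v₁ hA₁L hpar₁ fun k => k + b₁ = 1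
  have hd₁' : μ'.real {ω | 2 ≤ ((A₁.filter fun ℓ => s(v₁, ℓ) ∈ ω).card + b₁)} = d₁ := real_hair_decouple H w v₁ hA₁L hpar₁ fun k => 2 ≤ k + b₁
  have hu₁' : μ'.real {ω | 1 ≤ ((A₁.filter fun ℓ => s(v₁, ℓ) ∈ ω).card + b₁)} = u₁ := real_hair_decouple H w v₁ hA₁L hpar₁ fun k => 1 ≤ k + b₁
  have hz₁' : μ'.real {ω | ((A₁.filter fun ℓ => s(v₁, ℓ) ∈ ω).card + b₁) = 0} = z₁ := real_hair_decouple H w v₁ hA₁L hpar₁ fun k => k + b₁ = 0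
  have hd₂' : μ'.real {ω | 2 ≤ ((A₂.filter fun ℓ => s(v₂, ℓ) ∈ ω).card + b₂)} = d₂ := real_hair_decouple H w v₂ hA₂L hpar₂ fun k => 2 ≤ k + b₂
  have hu₂' : μ'.real {ω | 1 ≤ ((A₂.filter fun ℓ => s(v₂, ℓ) ∈ ω).card + b₂)} = u₂ := real_hair_decouple H w v₂ hA₂L hpar₂ fun k => 1 ≤ k + b₂
  -- internal numbers
  set hS := μ.real {ω | 1 ≤ ((A ∩ Z).filter fun a => onZ Z ω ∈ openConn c a).card} with hhS
  set tS := μ.real {ω | 2 ≤ ((A ∩ Z).filter fun a => onZ Z ω ∈ openConn c a).card} with htS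
  set hP := μ'.real {ω | 1 ≤ ((A ∩ Z).filter fun a => onZ Z ω ∈ openConn c a).card} with hhP
  set tP := μ'.real {ω | 2 ≤ ((A ∩ Z).filter fun a => onZ Z ω ∈ openConn c a).card} with htP
  have fS : hS = m₁ * (s₁ + d₁) + m₂ * (s₂ + d₂) - p * (s₁ + d₁) * (s₂ + d₂) := by
    have h := real_one_le_X_eq_loaded H w hwL hA
    rw [← hμ] at h
    change hS = μ.real (E₁ \ E₂) * u₁ + μ.real (E₂ \ E₁) * u₂ + μ.real (E₁ ∩ E₂) * u₁ + μ.real (E₁ ∩ E₂) * z₁ * u₂ at h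
    rw [h, h10, h01, ← hp, hz, hu, hu']; ring
  have fT : tS = m₁ * d₁ + m₂ * d₂ + p * (s₁ * (s₂ + d₂) - (s₁ + d₁) * d₂) := by
    have h := real_two_le_X_eq_loaded H w hwL hA
    rw [← hμ] at h
    change tS = μ.real (E₁ \ E₂) * d₁ + μ.real (E₂ \ E₁) * d₂ + μ.real (E₁ ∩ E₂) * d₁ + μ.real (E₁ ∩ E₂) * s₁ * u₂ +
      μ.real (E₁ ∩ E₂) * z₁ * d₂ at h
    rw [h, h10, h01, ← hp, hz, hu, hu']; ring
  have fP : hP = m₁ * (s₁ + d₁) + m₂ * (s₂ + d₂) - m₁ * m₂ * (s₁ + d₁) * (s₂ + d₂) := by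
    have h := real_one_le_X_eq_loaded H w' hw'L hA
    rw [← hμ'] at h
    change hP = μ'.real (E₁ \ E₂) * μ'.real {ω | 1 ≤ ((A₁.filter fun ℓ => s(v₁, ℓ) ∈ ω).card + b₁)} +
      μ'.real (E₂ \ E₁) * μ'.real {ω | 1 ≤ ((A₂.filter fun ℓ => s(v₂, ℓ) ∈ ω).card + b₂)} +
      μ'.real (E₁ ∩ E₂) * μ'.real {ω | 1 ≤ ((A₁.filter fun ℓ => s(v₁, ℓ) ∈ ω).card + b₁)} +
      μ'.real (E₁ ∩ E₂) * μ'.real {ω | ((A₁.filter fun ℓ => s(v₁, ℓ) ∈ ω).card + b₁) = 0} *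
        μ'.real {ω | 1 ≤ ((A₂.filter fun ℓ => s(v₂, ℓ) ∈ ω).card + b₂)} at h
    rw [h, h10', h01', hp', hu₁', hu₂', hz₁', hz, hu, hu']; ring
  have fQ : tP = m₁ * d₁ + m₂ * d₂ + m₁ * m₂ * (s₁ * (s₂ + d₂) - (s₁ + d₁) * d₂) := by
    have h := real_two_le_X_eq_loaded H w' hw'L hA
    rw [← hμ'] at h
    change tP = μ'.real (E₁ \ E₂) * μ'.real {ω | 2 ≤ ((A₁.filter fun ℓ => s(v₁, ℓ) ∈ ω).card + b₁)} +
      μ'.real (E₂ \ E₁) * μ'.real {ω | 2 ≤ ((A₂.filter fun ℓ => s(v₂, ℓ) ∈ ω).card + b₂)} +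
      μ'.real (E₁ ∩ E₂) * μ'.real {ω | 2 ≤ ((A₁.filter fun ℓ => s(v₁, ℓ) ∈ ω).card + b₁)} +
      μ'.real (E₁ ∩ E₂) * μ'.real {ω | ((A₁.filter fun ℓ => s(v₁, ℓ) ∈ ω).card + b₁) = 1} *
        μ'.real {ω | 1 ≤ ((A₂.filter fun ℓ => s(v₂, ℓ) ∈ ω).card + b₂)} +
      μ'.real (E₁ ∩ E₂) * μ'.real {ω | ((A₁.filter fun ℓ => s(v₁, ℓ) ∈ ω).card + b₁) = 0} *
        μ'.real {ω | 2 ≤ ((A₂.filter fun ℓ => s(v₂, ℓ) ∈ ω).card + b₂)} at h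
    rw [h, h10', h01', hp', hd₁', hd₂', hs₁', hu₂', hz₁', hz, hu, hu']; ring
  -- the least internal tip marginal
  set τ : Fin n → ℝ := fun a => μ.real {ω | onZ Z ω ∈ openConn c a} with hτ
  obtain ⟨a₀, ha₀, hmin⟩ := (A ∩ Z).exists_min_image τ hAZ
  set q := τ a₀ with hq
  have hq1 : q ≤ 1 := measureReal_le_one
  -- `q ≤ mᵢ uᵢ` through a loaded leaf `ℓ` with parent `vᵢ`
  have hleaf : ∀ {ℓ v : Fin n} {B : Finset (Fin n)} (b : ℕ), ℓ ∈ B → ℓ ∈ L → par ℓ = v →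
      τ ℓ ≤ μ.real {ω | core Z L ω ∈ openConn c v} * μ.real {ω | 1 ≤ (B.filter fun ℓ' => s(v, ℓ') ∈ ω).card + b} := by
    intro ℓ v B b hℓB hℓL hpv
    have h1 : τ ℓ = μ.real {ω | core Z L ω ∈ openConn c (par ℓ)} * (w s(par ℓ, ℓ) : ℝ) := real_onReach_leaf H w hwL hℓL
    rw [hpv] at h1
    rw [h1]
    refine mul_le_mul_of_nonneg_left ?_ measureReal_nonneg
    rw [← prodBernoulli_real_setOf_mem w s(v, ℓ)]
    refine measureReal_mono (fun ω hω => ?_)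
    simp only [mem_setOf_eq] at hω ⊢
    have hpos : 0 < (B.filter fun ℓ' => s(v, ℓ') ∈ ω).card := Finset.card_pos.2 ⟨ℓ, mem_filter.2 ⟨hℓB, hω⟩⟩
    omega
  have hsd₁ : s₁ + d₁ ≤ 1 := by rw [← hu]; exact hu₁1
  have hsd₂ : s₂ + d₂ ≤ 1 := by rw [← hu']; exact hu₂1
  -- an unloaded anchor has a trivial bundle
  have hempty : ∀ {v : Fin n} {B : Finset (Fin n)} {b : ℕ} (P : ℕ → Prop), B = ∅ → b = 0 → ¬ P 0 →
      μ.real {ω : BondConfig (Fin n) | P ((B.filter fun ℓ => s(v, ℓ) ∈ ω).card + b)} = 0 := by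
    intro v B b P hB hb hP
    have : {ω : BondConfig (Fin n) | P ((B.filter fun ℓ => s(v, ℓ) ∈ ω).card + b)} = ∅ := by
      ext ω
      simp only [hB, hb, Finset.filter_empty, Finset.card_empty, Nat.add_zero, mem_setOf_eq, Set.mem_empty_iff_false, iff_false]
      exact hP
    rw [this, measureReal_empty]
  -- a relay anchor: internal marginal `mᵢ`, loaded count `≥ 1` surely
  have hanchor : ∀ {v : Fin n}, v ∉ L → τ v = μ.real {ω | core Z L ω ∈ openConn c v} := fun {v} hvL =>
    real_congr_of_goodL w hwL _ _ fun ω hω => by simp only [mem_setOf_eq]; exact on_reach_iff_core H hω hvL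
  have hfull : ∀ {v : Fin n} {B : Finset (Fin n)} {b : ℕ}, b = 1 →
      μ.real {ω : BondConfig (Fin n) | 1 ≤ (B.filter fun ℓ => s(v, ℓ) ∈ ω).card + b} = 1 := by
    intro v B b hb
    have : {ω : BondConfig (Fin n) | 1 ≤ (B.filter fun ℓ => s(v, ℓ) ∈ ω).card + b} = Set.univ := by
      ext ω; simp only [mem_setOf_eq, Set.mem_univ, iff_true]; omega
    rw [this, probReal_univ]
  -- domination: both anchors loaded (real algebra) or one anchor loaded (the internal numbers coincide)
  have hdom : ∃ lam : ℝ, 0 ≤ lam ∧ lam ≤ 1 ∧ lam * hP + (1 - lam) * q ≤ hS ∧ lam * tP + (1 - lam) * q ≤ tS := by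
    -- `q ≤ mᵢ uᵢ` for a loaded anchor
    have hq₁' : A₁.Nonempty ∨ v₁ ∈ A → q ≤ m₁ * (s₁ + d₁) := by
      rintro (⟨ℓ₁, hℓ₁⟩ | hv)
      · rw [← hu]; exact (hmin ℓ₁ (by
          have h := (mem_filter.1 hℓ₁).1
          exact mem_inter.2 ⟨(mem_inter.1 (mem_inter.1 h).1).1, (mem_inter.1 h).2⟩)).trans (hleaf b₁ hℓ₁ (hA₁L hℓ₁) (hpar₁ ℓ₁ hℓ₁))
      · have hb : b₁ = 1 := by rw [hb₁, if_pos hv]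
        have hu1 : u₁ = 1 := hfull hb
        have hτ1 : τ v₁ = m₁ := hanchor H.v₁L
        rw [← hu, hu1, mul_one, ← hτ1]
        exact hmin v₁ (mem_inter.2 ⟨hv, H.v₁Z⟩)
    have hq₂' : A₂.Nonempty ∨ v₂ ∈ A → q ≤ m₂ * (s₂ + d₂) := by
      rintro (⟨ℓ₂, hℓ₂⟩ | hv)
      · rw [← hu']; exact (hmin ℓ₂ (by
          have h := (mem_filter.1 hℓ₂).1
          exact mem_inter.2 ⟨(mem_inter.1 (mem_inter.1 h).1).1, (mem_inter.1 h).2⟩)).trans (hleaf b₂ hℓ₂ (hA₂L hℓ₂) (hpar₂ ℓ₂ hℓ₂))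
      · have hb : b₂ = 1 := by rw [hb₂, if_pos hv]
        have hu2 : u₂ = 1 := hfull hb
        have hτ2 : τ v₂ = m₂ := hanchor H.v₂L
        rw [← hu', hu2, mul_one, ← hτ2]
        exact hmin v₂ (mem_inter.2 ⟨hv, H.v₂Z⟩)
    by_cases hl₁ : A₁.Nonempty ∨ v₁ ∈ A
    · by_cases hl₂ : A₂.Nonempty ∨ v₂ ∈ A
      · exact twoAnchor_dominates m₁ m₂ p s₁ d₁ s₂ d₂ q hS tS hP tP hm₁0 hm₂0 hp₁ hp₂ hpm
          hs₁0 hd₁0 hs₂0 hd₂0 hsd₁ hsd₂ (hq₁' hl₁) (hq₂' hl₂) fS fT fP fQ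
      · rw [not_or] at hl₂
        have hA₂e : A₂ = ∅ := Finset.not_nonempty_iff_eq_empty.1 hl₂.1
        have hb : b₂ = 0 := by rw [hb₂, if_neg hl₂.2]
        have hs₂z : s₂ = 0 := hempty (fun k => k = 1) hA₂e hb (by norm_num)
        have hd₂z : d₂ = 0 := hempty (fun k => 2 ≤ k) hA₂e hb (by norm_num)
        have e1 : hS = hP := by rw [fS, fP, hs₂z, hd₂z]; ring
        have e2 : tS = tP := by rw [fT, fQ, hs₂z, hd₂z]; ring
        exact ⟨1, zero_le_one, le_refl _, by rw [e1]; linarith, by rw [e2]; linarith⟩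
    · rw [not_or] at hl₁
      have hA₁e : A₁ = ∅ := Finset.not_nonempty_iff_eq_empty.1 hl₁.1
      have hb : b₁ = 0 := by rw [hb₁, if_neg hl₁.2]
      have hs₁z : s₁ = 0 := hempty (fun k => k = 1) hA₁e hb (by norm_num)
      have hd₁z : d₁ = 0 := hempty (fun k => 2 ≤ k) hA₁e hb (by norm_num)
      have e1 : hS = hP := by rw [fS, fP, hs₁z, hd₁z]; ring
      have e2 : tS = tP := by rw [fT, fQ, hs₁z, hd₁z]; ring
      exact ⟨1, zero_le_one, le_refl _, by rw [e1]; linarith, by rw [e2]; linarith⟩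
  obtain ⟨lam, hlam0, hlam1, hdomh, hdomt⟩ := hdom
  exact real_card_le_one_le_of_dominates w w' ho H.cZ hwZ (decouple_block_vanish H w) (fun e he => (decouple_of_avoid w he).symm)
    A t q lam hlam0 hlam1 hq1 ha₀ (le_refl _) (hcut a₀ ha₀) hdomh hdomt hfar'

/-! ## Marginals are preserved; the layer-one FAR instance transfers -/

/-- **Decoupling preserves the relay marginals** (block relays = leaves or anchors): `P_{w'}(o ↔ a) = P_w(o ↔ a)` for `a ∈ A`. [this work] -/
theorem real_openConn_decouple_eq_loaded (H : IsTwoAnchor c v₁ v₂ Z L par) (w : Sym2 (Fin n) → unitInterval) (ho : o ∉ Z)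
    (hwZ : ∀ x y : Fin n, x ≠ y → x ∈ Z → y ∉ Z → y ≠ c → (w s(x, y) : ℝ) = 0)
    (hwL : ∀ ℓ ∈ L, ∀ x : Fin n, x ≠ ℓ → x ≠ par ℓ → (w s(ℓ, x) : ℝ) = 0)
    {A : Finset (Fin n)} (hA : A ∩ Z ⊆ L ∪ {v₁, v₂}) {a : Fin n} (ha : a ∈ A) :
    (prodBernoulli (decouple c v₁ v₂ Z L par w)).real (openConn o a) = (prodBernoulli w).real (openConn o a) := by
  have hw'Z := decouple_block_vanish H w
  have hw'L := decouple_leaf_vanish H w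
  have hagree : ∀ e ∈ avoid Z, w e = decouple c v₁ v₂ Z L par w e := fun e he => (decouple_of_avoid w he).symm
  by_cases haZ : a ∈ Z
  · rw [real_openConn_in_eq (decouple c v₁ v₂ Z L par w) ho H.cZ hw'Z haZ, real_openConn_in_eq w ho H.cZ hwZ haZ,
      ← real_offZ_event_eq_of_agree w (decouple c v₁ v₂ Z L par w) Z hagree (fun η => η ∈ openConn o c)]
    by_cases haL : a ∈ L
    · -- a leaf: `P(o ↔ c off Z) · P(c ↔ par a in core) · weight of its hair`
      rw [real_onReach_leaf H (decouple c v₁ v₂ Z L par w) hw'L haL, real_onReach_leaf H w hwL haL, decouple_hair H w haL]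
      rcases H.parv a haL with hp | hp <;> rw [hp]
      · rw [real_coreReach_decouple₁ H w]
      · rw [real_coreReach_decouple₂ H w]
    · -- an anchor: `P(o ↔ c off Z) · mᵢ`
      have hanc : ∀ (u : Sym2 (Fin n) → unitInterval), (∀ ℓ ∈ L, ∀ x : Fin n, x ≠ ℓ → x ≠ par ℓ → (u s(ℓ, x) : ℝ) = 0) →
          (prodBernoulli u).real {ω | onZ Z ω ∈ openConn c a} = (prodBernoulli u).real {ω | core Z L ω ∈ openConn c a} :=
        fun u hu => real_congr_of_goodL u hu _ _ fun ω hω => by simp only [mem_setOf_eq]; exact on_reach_iff_core H hω haL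
      rw [hanc _ hw'L, hanc _ hwL]
      have h := hA (Finset.mem_inter.2 ⟨ha, haZ⟩)
      rw [Finset.mem_union, Finset.mem_insert, Finset.mem_singleton] at h
      rcases h with h | rfl | rfl
      · exact absurd h haL
      · rw [real_coreReach_decouple₁ H w]
      · rw [real_coreReach_decouple₂ H w]
  · rw [real_openConn_off_eq (c := c) (decouple c v₁ v₂ Z L par w) ho hw'Z haZ, real_openConn_off_eq (c := c) w ho hwZ haZ,
      ← real_offZ_event_eq_of_agree w (decouple c v₁ v₂ Z L par w) Z hagree (fun η => η ∈ openConn o a)]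

/-- **The layer-one FAR instance transfers from the decoupled graph.**  If for the decoupled weights `w'`
`2 < Σ_{a∈A} P_{w'}(o ↔ a)` and `P_{w'}(o ↮ a) ≤ t` on `A` imply `P_{w'}(#{a ∈ A : o ↔ a} ≤ 1) ≤ t`, then the same holds for `w`
(two-anchor pendant block, block relays = leaves or anchors, at least one). [this work] -/
theorem farLayerOne_twoAnchor_loaded (H : IsTwoAnchor c v₁ v₂ Z L par) (w : Sym2 (Fin n) → unitInterval) (ho : o ∉ Z)
    (hwZ : ∀ x y : Fin n, x ≠ y → x ∈ Z → y ∉ Z → y ≠ c → (w s(x, y) : ℝ) = 0)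
    (hwL : ∀ ℓ ∈ L, ∀ x : Fin n, x ≠ ℓ → x ≠ par ℓ → (w s(ℓ, x) : ℝ) = 0)
    (A : Finset (Fin n)) (hA : A ∩ Z ⊆ L ∪ {v₁, v₂}) (hAZ : (A ∩ Z).Nonempty) (t : ℝ)
    (hfar' : (2 : ℝ) < ∑ a ∈ A, (prodBernoulli (decouple c v₁ v₂ Z L par w)).real (openConn o a) →
      (∀ a ∈ A, (prodBernoulli (decouple c v₁ v₂ Z L par w)).real (openConn o a)ᶜ ≤ t) →
      (prodBernoulli (decouple c v₁ v₂ Z L par w)).real {ω : BondConfig (Fin n) | (A.filter fun a => ω ∈ openConn o a).card ≤ 1} ≤ t)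
    (hsum : (2 : ℝ) < ∑ a ∈ A, (prodBernoulli w).real (openConn o a))
    (hcut : ∀ a ∈ A, (prodBernoulli w).real (openConn o a)ᶜ ≤ t) :
    (prodBernoulli w).real {ω : BondConfig (Fin n) | (A.filter fun a => ω ∈ openConn o a).card ≤ 1} ≤ t := by
  have hmeas : ∀ U : Set (BondConfig (Fin n)), MeasurableSet U := fun U => (Set.toFinite U).measurableSet
  have hmarg : ∀ a ∈ A, (prodBernoulli (decouple c v₁ v₂ Z L par w)).real (openConn o a) = (prodBernoulli w).real (openConn o a) :=
    fun a ha => real_openConn_decouple_eq_loaded H w ho hwZ hwL hA ha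
  have hsum' : (2 : ℝ) < ∑ a ∈ A, (prodBernoulli (decouple c v₁ v₂ Z L par w)).real (openConn o a) := by
    rw [Finset.sum_congr rfl hmarg]; exact hsum
  have hcut' : ∀ a ∈ A, (prodBernoulli (decouple c v₁ v₂ Z L par w)).real (openConn o a)ᶜ ≤ t := by
    intro a ha
    rw [probReal_compl_eq_one_sub (hmeas _), hmarg a ha, ← probReal_compl_eq_one_sub (hmeas _)]
    exact hcut a ha
  exact real_card_le_one_le_twoAnchor_loaded H w ho hwZ hwL A hA hAZ t (fun a ha => hcut a (Finset.mem_inter.1 ha).1)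
    (hfar' hsum' hcut')


end Block

end Quant

end Summit.CriticalPhenomena.PercolationContinuityZ3.Theorems
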